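import Literature.Probability.LatticeModels.LoopErasedWalkIdentity
import Literature.Probability.LatticeModels.RandomWalkLoopDeterminant
import Literature.Probability.LatticeModels.PlanarIsing
import Mathlib.Combinatorics.SimpleGraph.Walk.Maps
import Mathlib.Analysis.Complex.Basic
import Mathlib.Analysis.SpecialFunctions.Exp

/-!
# `Z(Ω_δ|Ω'; 1, 1/4)` is the Green's function of the walk killed off the sub-graph — the lattice
# half of `SAWChargeContinuation.AnchorExcursion` (stmt-CriticalPhenomena-11196)

Route `SAWChargeContinuation` of `CriticalPhenomena/SAWScalingLimit`, support item `AnchorExcursion`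
(the `s = 1`, `y = 1/4` anchor of the charge window). The item's partition function is
`Z(Ω_δ|Ω'; s, y) = Σ_γ y^{|γ|} exp(s·m(γ))` over the self-avoiding walks `γ : a → b` of
`Ω_δ = discreteDomainGraph Ω δ` all of whose steps are edges of a sub-graph `H ≤ Ω_δ` (in the item,
`H = G Ω Ω' δ`, the edges of `Ω_δ` inside `cl Ω'` between mesh points of `Ω'`), `m(γ)` being the
random-walk loop measure of the loops of `H` meeting `γ` — the tree's `rwLoopMass H {v | v ∈ γ}`.
We prove the identity the item starts from (Lawler 2018, Prop. 3.1 with Prop. 5.2, summed over `η`):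

* `rwGreen_eq_tsum_paths` — for `G ≤ ℤ²` with finitely many edges,
  `G_G(a, b) = Σ_{η : a → b self-avoiding} 4^{-|η|} exp m[loops of G meeting η]` (in `ℝ≥0∞`): the
  fibres of chronological loop erasure partition the walks `a → b`, and each fibre is evaluated by
  the tree's DISCHARGED fact `tsum_loopErase_eq_exp_rwLoopMass_holds` (`LoopErasedWalkIdentity`);
* `tsum_domainSAW_eq_rwGreen` — the same sum written, as in the item, over the SAWs of `Ω_δ`
  (`SAW.DomainSAW Ω δ a b`) whose darts are `H`-edges, for any `H ≤ Ω_δ` with finitely many edges;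
* `tsum_domainSAW_complex_eq` — **`Z(Ω_δ|H; 1, 1/4) = G_H(a, b)`** in the item's complex typing,
  with the loop mass in the item's inlined `tsum` form (any `Decidable` instances);
* bookkeeping for `Ω_δ`: `edgeSet_finite_of_le`, `rwGreen_mono` (`H ≤ H' ⇒ G_H ≤ G_{H'}`, so the
  item's ratio lies in `[0, 1]`), `rwGreen_pos_of_reachable`, `rwGreen_domain_ne_top`.

NOT here: any limit `δ → 0` (the continuum half of the item is an invariance principle for the
killed walk at the two marked prime ends, not in the tree); no definitions.

Sources: G. F. Lawler, *Topics in loop measures and the loop-erased walk*, Probab. Surveys 15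
(2018), §2 (Green's function `Σ_η q̂(η) = q[𝒦_A(x,y)]`), Prop. 3.1, Prop. 5.2 [Lawler2018];
G. F. Lawler, V. Limic, *Random Walk: A Modern Introduction* (2010), Prop. 9.5.1 [LawlerLimic2010].
-/

noncomputable section

open scoped ENNReal
open Literature.Probability.RandomPlanarGeometry Literature.Probability.LatticeModels

namespace Summit.CriticalPhenomena.SAWScalingLimit.Theorems.AnchorExcursion

variable {G : SimpleGraph (Site 2)} {a b : Site 2}

/-! ## Loop erasure of a walk is the vertex list of exactly one walk, which is self-avoiding -/

/-- The chronological loop erasure of the vertex list of a walk `ω : a → b` of `G` is the vertex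
list of a walk `η : a → b` of `G` (it is a `G.Adj`-chain from `a` to `b`).
[cite: Lawler2018, §3 Definition 1] -/
theorem exists_support_eq_loopErase (ω : G.Walk a b) :
    ∃ η : G.Walk a b, η.support = loopErase ω.support := by
  have hc : (loopErase ω.support).IsChain G.Adj := isChain_loopErase ω.isChain_adj_support
  have hh : (loopErase ω.support).head? = some a := by
    rw [head?_loopErase, List.head?_eq_some_head ω.support_ne_nil, SimpleGraph.Walk.head_support]
  have hg : (loopErase ω.support).getLast? = some b := by
    rw [getLast?_loopErase, List.getLast?_eq_some_getLast ω.support_ne_nil,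
      SimpleGraph.Walk.getLast_support]
  refine ⟨(LoopErasedWalkIdentity.walkEquivList G a b).symm ⟨loopErase ω.support, hc, hh, hg⟩, ?_⟩
  exact congrArg Subtype.val
    ((LoopErasedWalkIdentity.walkEquivList G a b).apply_symm_apply ⟨loopErase ω.support, hc, hh, hg⟩)

/-- A walk whose vertex list is a loop erasure is self-avoiding. [cite: Lawler2018, §3 Definition 1] -/
theorem isPath_of_support_eq_loopErase {ω η : G.Walk a b} (h : η.support = loopErase ω.support) :
    η.IsPath := by
  rw [SimpleGraph.Walk.isPath_def, h]
  exact nodup_loopErase _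

/-- Two walks with the same loop-erased vertex list are equal (a walk of a simple graph is its
vertex list). [folklore] -/
theorem eq_of_support_eq_loopErase {ω η η' : G.Walk a b} (h : η.support = loopErase ω.support)
    (h' : η'.support = loopErase ω.support) : η = η' :=
  SimpleGraph.Walk.ext_support (h.trans h'.symm)

/-! ## The Green's function as a sum over self-avoiding paths -/

/-- The weight `4^{-|ω|}` of a walk sits in exactly one fibre of loop erasure. [folklore] -/
theorem pow_length_eq_tsum_ite (ω : G.Walk a b) :
    ((1 : ℝ≥0∞) / 4) ^ ω.length =
      ∑' η : G.Walk a b, if loopErase ω.support = η.support then ((1 : ℝ≥0∞) / 4) ^ ω.length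
        else 0 := by
  obtain ⟨η₀, hη₀⟩ := exists_support_eq_loopErase ω
  rw [tsum_eq_single η₀]
  · rw [if_pos hη₀.symm]
  · intro η hη
    rw [if_neg]
    intro h
    exact hη (eq_of_support_eq_loopErase h.symm hη₀)

/-- `G_G(a,b) = Σ_η Σ_{ω : LE(ω) = η} 4^{-|ω|}` ("`Σ_η q̂(η) = q[𝒦_A(x, y)]`", Lawler 2018 §3).
[cite: Lawler2018, §3 (display after Definition 2)] -/
theorem rwGreen_eq_tsum_tsum (a b : Site 2) :
    rwGreen G a b = ∑' η : G.Walk a b, ∑' ω : G.Walk a b,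
      if loopErase ω.support = η.support then ((1 : ℝ≥0∞) / 4) ^ ω.length else 0 := by
  rw [rwGreen, ENNReal.tsum_comm]
  exact tsum_congr fun ω => pow_length_eq_tsum_ite ω

/-- The fibre over a walk that is not self-avoiding is empty. [folklore] -/
theorem tsum_fibre_eq_zero_of_not_isPath {η : G.Walk a b} (hη : ¬ η.IsPath) :
    (∑' ω : G.Walk a b,
      if loopErase ω.support = η.support then ((1 : ℝ≥0∞) / 4) ^ ω.length else 0) = 0 := by
  refine ENNReal.tsum_eq_zero.2 fun ω => ?_
  rw [if_neg]
  intro h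
  exact hη (isPath_of_support_eq_loopErase h.symm)

/-- **Lawler's formula on a fibre, in `ℝ≥0∞`**: for `G ≤ ℤ²` with finitely many edges and a
self-avoiding `η : a → b`, `Σ_{ω : LE(ω) = η} 4^{-|ω|} = 4^{-|η|} exp m[loops of G meeting η]`
(the tree's discharged fact `tsum_loopErase_eq_exp_rwLoopMass_holds`, moved from `ℝ` to `ℝ≥0∞`).
[cite: Lawler2018, Proposition 3.1 and Proposition 5.2] -/
theorem tsum_fibre_eq_of_isPath (hG : G ≤ zdGraph 2) (hfin : G.edgeSet.Finite) {η : G.Walk a b}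
    (hη : η.IsPath) :
    (∑' ω : G.Walk a b,
      if loopErase ω.support = η.support then ((1 : ℝ≥0∞) / 4) ^ ω.length else 0) =
      ENNReal.ofReal (((1 : ℝ) / 4) ^ η.length * Real.exp (rwLoopMass G {v | v ∈ η.support})) := by
  have key := tsum_loopErase_eq_exp_rwLoopMass_holds G hG hfin a b η hη
  set f : G.Walk a b → ℝ := fun ω =>
    if loopErase ω.support = η.support then ((1 : ℝ) / 4) ^ ω.length else 0 with hf
  have hpos : 0 < ((1 : ℝ) / 4) ^ η.length * Real.exp (rwLoopMass G {v | v ∈ η.support}) := by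
    positivity
  have hf0 : ∀ ω, 0 ≤ f ω := fun ω => by
    simp only [hf]
    split_ifs <;> positivity
  have hsum : Summable f := by
    by_contra h
    rw [tsum_eq_zero_of_not_summable h] at key
    exact hpos.ne key
  have hterm : ∀ ω : G.Walk a b,
      (if loopErase ω.support = η.support then ((1 : ℝ≥0∞) / 4) ^ ω.length else 0) =
        ENNReal.ofReal (f ω) := by
    intro ω
    simp only [hf]
    split_ifs
    · rw [ENNReal.ofReal_pow (by norm_num), ENNReal.ofReal_div_of_pos (by norm_num),
        ENNReal.ofReal_one, ENNReal.ofReal_ofNat]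
    · rw [ENNReal.ofReal_zero]
  rw [tsum_congr hterm, ← ENNReal.ofReal_tsum_of_nonneg hf0 hsum, key]

/-- **The killed Green's function as a sum over self-avoiding paths** (Lawler 2018, §3 with
Prop. 3.1 and Prop. 5.2): for `G ≤ ℤ²` with finitely many edges,
`G_G(a, b) = Σ_{η : a → b self-avoiding} 4^{-|η|} · exp m[loops of G meeting η]`.
[cite: Lawler2018, Proposition 3.1 and Proposition 5.2] -/
theorem rwGreen_eq_tsum_paths (hG : G ≤ zdGraph 2) (hfin : G.edgeSet.Finite) (a b : Site 2)
    [∀ η : G.Walk a b, Decidable η.IsPath] :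
    rwGreen G a b = ∑' η : G.Walk a b,
      if η.IsPath then
        ENNReal.ofReal (((1 : ℝ) / 4) ^ η.length * Real.exp (rwLoopMass G {v | v ∈ η.support}))
      else 0 := by
  rw [rwGreen_eq_tsum_tsum]
  refine tsum_congr fun η => ?_
  by_cases hη : η.IsPath
  · rw [if_pos hη, tsum_fibre_eq_of_isPath hG hfin hη]
  · rw [if_neg hη, tsum_fibre_eq_zero_of_not_isPath hη]

/-! ## Transfer to the self-avoiding walks of `Ω_δ` confined to a sub-graph `H ≤ Ω_δ` -/

section Domain

variable {Ω : Set ℂ} {δ : ℝ} {H : SimpleGraph (Site 2)}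

/-- "Every dart of the walk is an `H`-edge" (the item's indicator) iff every edge of the walk lies
in `H.edgeSet` (the hypothesis of `SimpleGraph.Walk.transfer`). [folklore] -/
theorem forall_darts_adj_iff_forall_edges {K : SimpleGraph (Site 2)} {u v : Site 2}
    (p : K.Walk u v) :
    (∀ e ∈ p.darts, H.Adj e.fst e.snd) ↔ ∀ e ∈ p.edges, e ∈ H.edgeSet := by
  rw [SimpleGraph.Walk.edges]
  simp only [List.mem_map, forall_exists_index, and_imp, forall_apply_eq_imp_iff₂,
    SimpleGraph.Dart.edge, SimpleGraph.mem_edgeSet]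

/-- The SAWs of `Ω_δ` whose darts are `H`-edges are in bijection with the self-avoiding walks of
the sub-graph `H ≤ Ω_δ` (`SimpleGraph.Walk.transfer` both ways), preserving length and vertex
list. [folklore] -/
theorem exists_equiv_transfer (hH : H ≤ discreteDomainGraph Ω δ) (a b : Site 2) :
    ∃ e : {γ : SAW.DomainSAW Ω δ a b // ∀ d ∈ γ.walk.darts, H.Adj d.fst d.snd} ≃
        {η : H.Walk a b // η.IsPath},
      ∀ γ, (e γ).1.length = γ.1.length ∧ (e γ).1.support = γ.1.walk.support := by
  classical
  refine ⟨{ toFun := fun γ => ⟨γ.1.walk.transfer H ((forall_darts_adj_iff_forall_edges _).1 γ.2),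
              γ.1.isPath.transfer _⟩
            invFun := fun η => ⟨⟨η.1.transfer (discreteDomainGraph Ω δ)
                (fun e he => SimpleGraph.edgeSet_mono hH (η.1.edges_subset_edgeSet he)),
                η.2.transfer _⟩,
              (forall_darts_adj_iff_forall_edges _).2 (by
                intro e he
                rw [SimpleGraph.Walk.edges_transfer] at he
                exact η.1.edges_subset_edgeSet he)⟩
            left_inv := fun γ => by
              apply Subtype.ext
              apply SAW.DomainSAW.eq_of_walk_eq
              simp only [SimpleGraph.Walk.transfer_transfer, SimpleGraph.Walk.transfer_self]
            right_inv := fun η => by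
              apply Subtype.ext
              simp only [SimpleGraph.Walk.transfer_transfer, SimpleGraph.Walk.transfer_self] },
    fun γ => ⟨?_, ?_⟩⟩
  · exact SimpleGraph.Walk.length_transfer _ _
  · exact SimpleGraph.Walk.support_transfer _ _

/-- **`Σ_{γ SAW of Ω_δ in H} 4^{-|γ|} e^{m_H(γ)} = G_H(a, b)`** (in `ℝ≥0∞`): the item's sum over the
SAWs of `Ω_δ` whose darts are edges of a sub-graph `H ≤ Ω_δ` with finitely many edges, weighted by
`4^{-|γ|}` times the exponential of the loop measure of the loops of `H` meeting `γ`, is the Green's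
function of the simple random walk killed off `H` (Lawler 2018, §3: `Σ_η q̂(η) = G_A(a, b)` with
Prop. 3.1 and Prop. 5.2). Any `Decidable` instance for the indicator.
[cite: Lawler2018, Proposition 3.1 and Proposition 5.2] -/
theorem tsum_domainSAW_eq_rwGreen (hH : H ≤ discreteDomainGraph Ω δ) (hfin : H.edgeSet.Finite)
    (a b : Site 2) [∀ γ : SAW.DomainSAW Ω δ a b, Decidable (∀ d ∈ γ.walk.darts, H.Adj d.fst d.snd)] :
    (∑' γ : SAW.DomainSAW Ω δ a b,
      if (∀ d ∈ γ.walk.darts, H.Adj d.fst d.snd) then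
        ENNReal.ofReal (((1 : ℝ) / 4) ^ γ.length *
          Real.exp (rwLoopMass H {v | v ∈ γ.walk.support}))
      else 0) = rwGreen H a b := by
  classical
  have hG : H ≤ zdGraph 2 :=
    hH.trans ((discreteDomainGraph_le_meshGraph Ω δ).trans (meshGraph_le_zdGraph Ω δ))
  -- the weight, as a function of (length, vertex list)
  set g : ℕ → List (Site 2) → ℝ≥0∞ := fun n l =>
    ENNReal.ofReal (((1 : ℝ) / 4) ^ n * Real.exp (rwLoopMass H {v | v ∈ l})) with hg
  obtain ⟨e, he⟩ := exists_equiv_transfer hH a b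
  -- left-hand side as a sum over the subtype
  have hL : (∑' γ : SAW.DomainSAW Ω δ a b,
      if (∀ d ∈ γ.walk.darts, H.Adj d.fst d.snd) then g γ.length γ.walk.support else 0) =
      ∑' γ : {γ : SAW.DomainSAW Ω δ a b // ∀ d ∈ γ.walk.darts, H.Adj d.fst d.snd},
        g γ.1.length γ.1.walk.support := by
    rw [LoopErasedWalkIdentity.tsum_subtype_eq_tsum_ite
      (fun γ : SAW.DomainSAW Ω δ a b => ∀ d ∈ γ.walk.darts, H.Adj d.fst d.snd)
      (fun γ : SAW.DomainSAW Ω δ a b => g γ.length γ.walk.support)]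
    exact tsum_congr fun γ => LoopErasedWalkIdentity.ite_congr_prop _ _ Iff.rfl
  -- right-hand side as a sum over the subtype of self-avoiding walks of `H`
  have hR : (∑' η : H.Walk a b, if η.IsPath then g η.length η.support else 0) =
      ∑' η : {η : H.Walk a b // η.IsPath}, g η.1.length η.1.support := by
    rw [LoopErasedWalkIdentity.tsum_subtype_eq_tsum_ite (fun η : H.Walk a b => η.IsPath)
      (fun η : H.Walk a b => g η.length η.support)]
    exact tsum_congr fun η => LoopErasedWalkIdentity.ite_congr_prop _ _ Iff.rfl
  have hL' : (∑' γ : SAW.DomainSAW Ω δ a b,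
      if (∀ d ∈ γ.walk.darts, H.Adj d.fst d.snd) then
        ENNReal.ofReal (((1 : ℝ) / 4) ^ γ.length *
          Real.exp (rwLoopMass H {v | v ∈ γ.walk.support}))
      else 0) = ∑' γ : SAW.DomainSAW Ω δ a b,
      if (∀ d ∈ γ.walk.darts, H.Adj d.fst d.snd) then g γ.length γ.walk.support else 0 :=
    tsum_congr fun γ => by simp only [hg, SAW.DomainSAW.length]
  rw [hL', hL, rwGreen_eq_tsum_paths hG hfin a b, hR, ← e.symm.tsum_eq]
  refine tsum_congr fun η => ?_
  obtain ⟨h1, h2⟩ := he (e.symm η)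
  rw [e.apply_symm_apply] at h1 h2
  rw [h1, h2]

/-- The item's inlined loop mass is the tree's `rwLoopMass` (any `Decidable` instances): the sum
over rooted closed walks of `H` of positive length meeting the vertex LIST `l`, of
`(1/4)^{|p|}/|p|`, is `m[loops of H meeting {v | v ∈ l}]`. [cite: Lawler2018, Definition 8 and Definition 10] -/
theorem tsum_ite_list_eq_rwLoopMass (H : SimpleGraph (Site 2)) (l : List (Site 2))
    (inst : ∀ p : (Σ x : Site 2, H.Walk x x),
      Decidable (0 < p.2.length ∧ ∃ v ∈ p.2.support, v ∈ l)) :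
    (∑' p : (Σ x : Site 2, H.Walk x x),
      @ite ℝ (0 < p.2.length ∧ ∃ v ∈ p.2.support, v ∈ l) (inst p)
        (((1 : ℝ) / 4) ^ p.2.length / (p.2.length : ℝ)) 0) = rwLoopMass H {v | v ∈ l} := by
  unfold rwLoopMass
  refine tsum_congr fun p => ?_
  by_cases h : 0 < p.2.length ∧ ∃ v ∈ p.2.support, v ∈ l
  · rw [if_pos h, if_pos (by simpa only [Set.mem_setOf_eq] using h)]
  · rw [if_neg h, if_neg (by simpa only [Set.mem_setOf_eq] using h)]

/-- **`Z(Ω_δ|H; 1, 1/4) = G_H(a, b)` in the typing of item `AnchorExcursion`**: with complex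
fugacity `y = 1/4` and charge `s = 1`, the sum over the SAWs `γ : a → b` of `Ω_δ` whose darts are
`H`-edges of `y^{|γ|} · exp(s · m_H(γ))` — `m_H(γ)` the item's inlined loop-mass `tsum` — equals
`((rwGreen H a b).toReal : ℂ)`, the Green's function of the walk killed off `H`, for every sub-graph
`H ≤ Ω_δ` with finitely many edges (Lawler 2018, Prop. 3.1 with Prop. 5.2, summed over `η`). Any
`Decidable` instances. If `G_H(a, b) = ∞` both sides are `0` (junk; impossible on finite `Ω_δ`,
`rwGreen_domain_ne_top`). [cite: Lawler2018, Proposition 3.1 and Proposition 5.2] -/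
theorem tsum_domainSAW_complex_eq (hH : H ≤ discreteDomainGraph Ω δ) (hfin : H.edgeSet.Finite)
    (a b : Site 2) (inst₁ : ∀ γ : SAW.DomainSAW Ω δ a b, Decidable (∀ d ∈ γ.walk.darts, H.Adj d.fst d.snd))
    (inst₂ : ∀ (γ : SAW.DomainSAW Ω δ a b) (p : (Σ x : Site 2, H.Walk x x)),
      Decidable (0 < p.2.length ∧ ∃ v ∈ p.2.support, v ∈ γ.walk.support)) :
    (∑' γ : SAW.DomainSAW Ω δ a b,
      @ite ℂ (∀ d ∈ γ.walk.darts, H.Adj d.fst d.snd) (inst₁ γ)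
        ((1 / 4 : ℂ) ^ γ.length * Complex.exp (1 * ((∑' p : (Σ x : Site 2, H.Walk x x),
          @ite ℝ (0 < p.2.length ∧ ∃ v ∈ p.2.support, v ∈ γ.walk.support) (inst₂ γ p)
            (((1 : ℝ) / 4) ^ p.2.length / (p.2.length : ℝ)) 0 : ℝ) : ℂ)))
        0) = ((rwGreen H a b).toReal : ℂ) := by
  -- the real weights
  set t : SAW.DomainSAW Ω δ a b → ℝ := fun γ =>
    @ite ℝ (∀ d ∈ γ.walk.darts, H.Adj d.fst d.snd) (inst₁ γ)
      (((1 : ℝ) / 4) ^ γ.length * Real.exp (rwLoopMass H {v | v ∈ γ.walk.support})) 0 with ht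
  have ht0 : ∀ γ, 0 ≤ t γ := fun γ => by
    simp only [ht]
    split_ifs <;> positivity
  -- each complex term is the real weight
  have hterm : ∀ γ : SAW.DomainSAW Ω δ a b,
      @ite ℂ (∀ d ∈ γ.walk.darts, H.Adj d.fst d.snd) (inst₁ γ)
        ((1 / 4 : ℂ) ^ γ.length * Complex.exp (1 * ((∑' p : (Σ x : Site 2, H.Walk x x),
          @ite ℝ (0 < p.2.length ∧ ∃ v ∈ p.2.support, v ∈ γ.walk.support) (inst₂ γ p)
            (((1 : ℝ) / 4) ^ p.2.length / (p.2.length : ℝ)) 0 : ℝ) : ℂ)))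
        0 = ((t γ : ℝ) : ℂ) := by
    intro γ
    simp only [ht]
    split_ifs
    · rw [tsum_ite_list_eq_rwLoopMass H γ.walk.support (inst₂ γ), one_mul, Complex.ofReal_mul,
        Complex.ofReal_exp, Complex.ofReal_pow]
      push_cast
      ring
    · simp
  rw [tsum_congr hterm, ← Complex.ofReal_tsum]
  congr 1
  -- the real sum is the `toReal` of the `ℝ≥0∞` sum
  have hreal : ∀ γ, t γ = (ENNReal.ofReal (t γ)).toReal := fun γ =>
    (ENNReal.toReal_ofReal (ht0 γ)).symm
  rw [tsum_congr hreal, ← ENNReal.tsum_toReal_eq (fun γ => ENNReal.ofReal_ne_top)]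
  congr 1
  rw [← tsum_domainSAW_eq_rwGreen hH hfin a b]
  refine tsum_congr fun γ => ?_
  simp only [ht]
  split_ifs
  · rfl
  · exact ENNReal.ofReal_zero

end Domain

/-! ## Bookkeeping on `Ω_δ`: finiteness of edges, monotonicity, positivity, finiteness of `G` -/

section Bookkeeping

variable {Ω : Set ℂ} {δ : ℝ}

/-- A sub-graph of `Ω_δ` has finitely many edges when `Ω` is bounded and `δ > 0` (both ends of an
edge of `Ω_δ` lie in the finite discrete domain `meshDomain Ω δ`). [folklore] -/
theorem edgeSet_finite_of_le {H : SimpleGraph (Site 2)} (hH : H ≤ discreteDomainGraph Ω δ)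
    (hΩ : Bornology.IsBounded Ω) (hδ : 0 < δ) : H.edgeSet.Finite := by
  have hfin := meshDomain_finite hΩ hδ
  refine ((hfin.prod hfin).image fun p : Site 2 × Site 2 => s(p.1, p.2)).subset ?_
  intro e he
  induction e using Sym2.ind with
  | _ x y =>
    have hxy := discreteDomainGraph_adj_iff.1 (hH ((SimpleGraph.mem_edgeSet H).1 he))
    exact ⟨(x, y), ⟨hxy.2.1, hxy.2.2⟩, rfl⟩

/-- **Monotonicity of the killed Green's function in the graph**: `H ≤ H' ⇒ G_H(a,b) ≤ G_{H'}(a,b)`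
(every walk of `H` is a walk of `H'` of the same length). In particular the item's ratio
`G_{H}(a,b)/G_{Ω_δ}(a,b)` lies in `[0, 1]`. [folklore] -/
theorem rwGreen_mono {H H' : SimpleGraph (Site 2)} (h : H ≤ H') (a b : Site 2) :
    rwGreen H a b ≤ rwGreen H' a b := by
  rw [rwGreen, rwGreen]
  have hinj : Function.Injective
      (fun ω : H.Walk a b => ω.transfer H' fun e he => SimpleGraph.edgeSet_mono h
        (ω.edges_subset_edgeSet he)) := by
    intro ω ω' hω
    apply SimpleGraph.Walk.ext_support
    have := congrArg SimpleGraph.Walk.support hω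
    simpa only [SimpleGraph.Walk.support_transfer] using this
  calc (∑' ω : H.Walk a b, ((1 : ℝ≥0∞) / 4) ^ ω.length)
      = ∑' ω : H.Walk a b, ((1 : ℝ≥0∞) / 4) ^ ((fun ω : H.Walk a b => ω.transfer H'
          fun e he => SimpleGraph.edgeSet_mono h (ω.edges_subset_edgeSet he)) ω).length := by
        simp only [SimpleGraph.Walk.length_transfer]
    _ ≤ ∑' ω' : H'.Walk a b, ((1 : ℝ≥0∞) / 4) ^ ω'.length :=
        ENNReal.tsum_comp_le_tsum_of_injective hinj (fun ω' : H'.Walk a b => ((1 : ℝ≥0∞) / 4) ^ ω'.length)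

/-- The Green's function dominates the weight of any single walk: `4^{-|ω|} ≤ G_H(a, b)`; in
particular `G_H(a,b) > 0` as soon as `b` is reachable from `a` in `H`. [folklore] -/
theorem pow_length_le_rwGreen {H : SimpleGraph (Site 2)} (ω : H.Walk a b) :
    ((1 : ℝ≥0∞) / 4) ^ ω.length ≤ rwGreen H a b :=
  ENNReal.le_tsum ω

/-- `G_H(a, b) > 0` when `b` is reachable from `a` in `H`. [folklore] -/
theorem rwGreen_pos_of_reachable {H : SimpleGraph (Site 2)} (h : H.Reachable a b) :
    0 < rwGreen H a b := by
  obtain ⟨ω⟩ := h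
  refine lt_of_lt_of_le ?_ (pow_length_le_rwGreen ω)
  exact ENNReal.pow_pos (by simp) _

/-- On a bounded domain at positive mesh, the killed Green's function of any sub-graph `H ≤ Ω_δ`
between two vertices of `Ω_δ` is finite (the killed walk on a finite piece of `ℤ²` is transient;
tree: `rwGreen_ne_top`). [cite: Lawler2018, §2 (integrable weights)] -/
theorem rwGreen_domain_ne_top {H : SimpleGraph (Site 2)} (hH : H ≤ discreteDomainGraph Ω δ)
    (hΩ : Bornology.IsBounded Ω) (hδ : 0 < δ) (ha : a ∈ meshDomain Ω δ) (hb : b ∈ meshDomain Ω δ) :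
    rwGreen H a b ≠ ⊤ := by
  have hG : H ≤ zdGraph 2 :=
    hH.trans ((discreteDomainGraph_le_meshGraph Ω δ).trans (meshGraph_le_zdGraph Ω δ))
  have ha' : a ∈ meshDomainFinset Ω δ := by rwa [← Finset.mem_coe, coe_meshDomainFinset hΩ hδ]
  have hb' : b ∈ meshDomainFinset Ω δ := by rwa [← Finset.mem_coe, coe_meshDomainFinset hΩ hδ]
  have hV : ∀ x y : Site 2, H.Adj x y → x ∈ meshDomainFinset Ω δ := by
    intro x y hxy
    rw [← Finset.mem_coe, coe_meshDomainFinset hΩ hδ]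
    exact (discreteDomainGraph_adj_iff.1 (hH hxy)).2.1
  exact rwGreen_ne_top hG hV ⟨a, ha'⟩ ⟨b, hb'⟩

/-- Hence the ratio of the item is at most `1`: `(G_H(a,b)).toReal ≤ (G_{Ω_δ}(a,b)).toReal` for
`H ≤ Ω_δ` on a bounded domain, `δ > 0`, `a, b ∈ Ω_δ`. [folklore] -/
theorem toReal_rwGreen_le {H : SimpleGraph (Site 2)} (hH : H ≤ discreteDomainGraph Ω δ)
    (hΩ : Bornology.IsBounded Ω) (hδ : 0 < δ) (ha : a ∈ meshDomain Ω δ) (hb : b ∈ meshDomain Ω δ) :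
    (rwGreen H a b).toReal ≤ (rwGreen (discreteDomainGraph Ω δ) a b).toReal :=
  ENNReal.toReal_mono (rwGreen_domain_ne_top le_rfl hΩ hδ ha hb) (rwGreen_mono hH a b)

end Bookkeeping

end Summit.CriticalPhenomena.SAWScalingLimit.Theorems.AnchorExcursion

end
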